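import Summits.BirchSwinnertonDyer.Rank1Residual.GaloisImage.HauptmodulNineTowerFive
import Summits.BirchSwinnertonDyer.Rank1Residual.GaloisImage.HauptmodulNineValuationVZero
import HarnessLib

/-!
# The `3`-adic tower on the EXOTIC core at `v₃(j) ≡ 0 (mod 3)`, `v₃(j) ≥ 6`, `j/3^{v₃(j)} ≡ ±2 (mod 9)`:
# `ρ̄_{E,3}` onto implies `ρ̄_{E,3ⁿ}` onto for every `n` — via the level-`9` Hauptmodul
# (cell `b2b-bsdres`, team n1011, seat p02 gen 5 — row T-b11-F4 'scalar-stabiliser tower criterion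
# at 9', file F4c-H14: the assembly of the Hauptmodul route for `v₃(j) = 3k + 3 ≥ 6`)

HONEST FRAMING (cell `b2b-bsdres`, run/shared/lean/b2b/bsd-rank1-residual/, verbatim in every
file): the goal of the cell is to DELETE the COMBINATION-SHAPED residual classes of the
Birch–Swinnerton-Dyer formula for ALL analytic-rank `≤ 1` elliptic curves over `ℚ` — "full BSD
formula for every rank `≤ 1` curve in class `C`" assembled STRICTLY from published theorems — so
that the rank-`≤ 1` remainder becomes exactly the CONSTRUCTION-SHAPED classes, which are TYPED
(missing-input `Prop`s), NOT attempted. This is not "finishing BSD". Team n1011 (N10 / N11):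
research route; no claim beyond the stated classes; labels UNCHANGED; nothing is booked. Theorems
only (no definition, no named fact).

## What this file proves

* `padicValRat_j_of_nine_dvd_num` — `9 ∣ num(j/3^{3k+3} + 2w₀)` (`w₀ = ±1`) ⟹ `v₃(j) = 3k + 3`.
* **`towerSurj_three_of_surj_of_nine_dvd_num_vzero`** — for `E/ℚ` with `ρ̄_{E,3}` onto, `k ≥ 1`,
  `w₀ = ±1` and `9 ∣ num(j(E)/3^{3k+3} + 2w₀)` (i.e. `v₃(j) = 3k + 3` and `j/3^{v₃(j)} ≡ −2w₀
  (mod 9)`): `ρ̄_{E,3ⁿ}` is onto for every `n`.  As in `HauptmodulNineTower`, with the invariant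
  `z = (2((θ³ − 24)/3^{k+1} − w₀)/θ)² − 1` of valuation `1/9` (`HauptmodulNineValuationVZero`).
* `imageContainsSL2_three_of_surj_of_nine_dvd_num_vzero` — Kato's (12.5.2) at `p = 3`.

This discharges by a KERNEL PROOF the fourth family of the EXOTIC core of the cell's `3`-adic census
(`v₃(j) ∈ {6, 9, 12, …}`, `j/3^{v₃(j)} ≡ ±2 (mod 9)`: 155 of the 749 `m = 3` cells — 94 at
`v₃(j) = 6`, 27 at `9`, 34 at `≥ 12`; EVIDENCE kit j135556).  With `HauptmodulNineTower` (142),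
`HauptmodulNineTowerFive` (117) and `HauptmodulNineTowerThree` (84) the Hauptmodul route covers
498 of the 749 cells.  NOT claimed: `v₃(j) ≡ 0 (mod 3)` with `j/3^{v₃(j)} ≡ ±1 (mod 9)` (22 cells),
`v₃(j) = 3` with `j/27 ≡ 8 (mod 9)` (27), and `v₃(j) ≡ 1, 2 (mod 3)`, `v₃(j) ≥ 7` (202) — for 123
of these no prime of `ℚ(θ)` over `3` has `9 ∣ ef` (kit j135556), so no `Stab`-invariant of a CYCLIC
`9`-group can work there.  Nothing booked; no label change.

References: [Maier2006] Table 4 (N = 3, 9), §5; [SerreAbelianLadic1968] IV-23;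
[SerreLocalFields1979] Ch. I §7; [Kato2004Asterisque] (12.5.2).
-/

noncomputable section

set_option maxRecDepth 10000

open scoped Classical

open WeierstrassCurve Field

namespace Summit.BirchSwinnertonDyer.Rank1Residual.GaloisImage

open Literature.NumberTheory.EllipticCurves Literature.NumberTheory.GaloisRepresentations
  Rat.HeightOneSpectrum

variable (W : WeierstrassCurve ℚ) [W.IsElliptic]

omit [W.IsElliptic] in
/-- `9 ∣ num(q/3^{3k+3} + 2w₀)` with `w₀ = ±1` ⟹ `v₃(q) = 3k + 3` (for any rational `q`; applied to
`q = j(E)`). [folklore] -/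
theorem padicValRat_eq_of_nine_dvd_num {q : ℚ} {k : ℕ} {w₀ : ℤ} (hw₀ : w₀ = 1 ∨ w₀ = -1)
    (h : (9 : ℤ) ∣ (q / 3 ^ (3 * k + 3) + 2 * w₀).num) :
    padicValRat 3 q = ((3 * k + 3 : ℕ) : ℤ) := by
  haveI : Fact (Nat.Prime 3) := ⟨Nat.prime_three⟩
  have h2w : padicValRat 3 (-(2 * w₀ : ℚ)) = 0 := by
    rw [padicValRat.neg]
    rcases hw₀ with hw | hw
    · rw [hw]; norm_num
      rw [show (2 : ℚ) = ((2 : ℕ) : ℚ) by norm_num, padicValRat.of_nat,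
        padicValNat.eq_zero_of_not_dvd (by norm_num)]; rfl
    · rw [hw]; norm_num
      rw [show (2 : ℚ) = ((2 : ℕ) : ℚ) by norm_num, padicValRat.of_nat,
        padicValNat.eq_zero_of_not_dvd (by norm_num)]; rfl
  have h2w0 : -(2 * w₀ : ℚ) ≠ 0 := by
    rcases hw₀ with hw | hw <;> rw [hw] <;> norm_num
  -- `v₃(q/3^V) = 0`
  have hq0 : padicValRat 3 (q / 3 ^ (3 * k + 3)) = 0 ∧ q / 3 ^ (3 * k + 3) ≠ 0 := by
    have e : q / 3 ^ (3 * k + 3) = -(2 * w₀ : ℚ) + (q / 3 ^ (3 * k + 3) + 2 * w₀) := by ring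
    by_cases hz : q / 3 ^ (3 * k + 3) + 2 * w₀ = 0
    · rw [e, hz, add_zero]; exact ⟨h2w, h2w0⟩
    have h2 := two_le_padicValRat_of_nine_dvd_num hz h
    have hne : -(2 * w₀ : ℚ) + (q / 3 ^ (3 * k + 3) + 2 * w₀) ≠ 0 := by
      intro h0
      have e' : q / 3 ^ (3 * k + 3) + 2 * w₀ = 2 * w₀ := by linear_combination h0
      rw [e', ← padicValRat.neg] at h2
      rw [h2w] at h2
      norm_num at h2
    refine ⟨?_, by rw [e]; exact hne⟩
    rw [e, padicValRat.add_eq_min hne h2w0 hz (by rw [h2w]; omega), h2w]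
    exact min_eq_left (by omega)
  have hq : q = 3 ^ (3 * k + 3) * (q / 3 ^ (3 * k + 3)) := by
    rw [mul_div_cancel₀ _ (pow_ne_zero _ (by norm_num : (3 : ℚ) ≠ 0))]
  have h33 : padicValRat 3 (3 : ℚ) = 1 := by exact_mod_cast padicValRat.self (p := 3) (by norm_num)
  rw [hq, padicValRat.mul (pow_ne_zero _ (by norm_num)) hq0.2, hq0.1, padicValRat.pow, h33]
  · push_cast; ring

/-- **THE TOWER AT `v₃(j) = 3k + 3 ≥ 6`, `j/3^{v₃(j)} ≡ ±2 (mod 9)`.**  For `E/ℚ` with `ρ̄_{E,3}`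
onto, `k ≥ 1`, `w₀ = ±1` and `9 ∣ num(j/3^{3k+3} + 2w₀)`, `ρ̄_{E,3ⁿ}` is onto for every `n`
(level-`9` Hauptmodul: the `Stab(ℤQ)`-invariant `z = (2((θ³ − 24)/3^{k+1} − w₀)/θ)² − 1 ∈ ℚ(E[9])`,
`θ = η(E, ℤQ) + 3`, has `3`-adic valuation exactly `1/9`; scalar-stabiliser tower criterion).
[cite: SerreAbelianLadic1968, Ch. IV §3.4, Lemma 3 (IV-23)] [cite: Maier2006, Table 4 (N = 9) and §5] -/
theorem towerSurj_three_of_surj_of_nine_dvd_num_vzero (hsurj : W.HasSurjectiveModNGaloisRep 3)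
    {k : ℕ} (hk : 1 ≤ k) {w₀ : ℤ} (hw₀ : w₀ = 1 ∨ w₀ = -1)
    (hj0 : (9 : ℤ) ∣ (W.j / 3 ^ (3 * k + 3) + 2 * w₀).num) (n : ℕ) :
    W.HasSurjectiveModNGaloisRep (3 ^ n : ℕ) := by
  haveI : Fact (Nat.Prime 3) := ⟨Nat.prime_three⟩
  set v := (placeOver 3).valuation with hv
  set t := v (3 : AlgebraicClosure ℚ) with ht
  have ht0 : t ≠ 0 := valuation_three_ne_zero
  -- (1) a `9`-torsion point above a non-canonical `3`-torsion point, `v(S(3Q))³ = t³`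
  have hjV := padicValRat_eq_of_nine_dvd_num hw₀ hj0
  have hj3 := padicValRat_j_sub_1728_of_four_le W (by rw [hjV]; push_cast; omega)
  obtain ⟨Q, x₃, y₃, h₃, hQ9, hQ3, -, hvalS⟩ :=
    exists_nineTorsion_hauptmodul_three_valuation W (m := 3) (by norm_num) (by norm_num) hj3
  have h3Q : (3 ^ 1 : ℕ) • Q ≠ 0 := by
    rw [pow_one, ← natCast_zsmul, Nat.cast_ofNat, hQ3]
    exact Affine.Point.some_ne_zero h₃
  have h9Q : (3 ^ (1 + 1) : ℕ) • Q = 0 := by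
    rw [← natCast_zsmul]; exact_mod_cast hQ9
  have h9 : addOrderOf Q = 9 := by
    have := addOrderOf_eq_prime_pow h3Q h9Q
    norm_num at this
    exact this
  -- (2) the invariant `θ`
  obtain ⟨θ, hθL, hθfix, hjθ, hSθ⟩ := exists_hauptmodulNine_invariant W h9 hQ3
  have hSθ' : (W.map (algebraMap ℚ (AlgebraicClosure ℚ))).tgA₁ x₃ y₃ ^ 3 /
      (W.map (algebraMap ℚ (AlgebraicClosure ℚ))).tgA₃ x₃ y₃ = θ ^ 3 := hSθ
  rw [hSθ'] at hvalS
  have hvS : v (θ ^ 3) = t := (pow_left_inj₀ zero_le zero_le three_ne_zero).mp hvalS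
  -- (3) the curve-free core: `v(z)⁹ = t`
  have hz := valuation_hauptmodul_nine_invariant_vzero_pow_nine hk hw₀ hj0 hjθ hvS rfl
  have hz0 : (2 * ((θ ^ 3 - 24) / 3 ^ (k + 1) - (w₀ : AlgebraicClosure ℚ)) / θ) ^ 2 - 1 ≠ 0 := by
    intro h0
    rw [h0, map_zero, zero_pow (by norm_num)] at hz
    exact ht0 hz.symm
  -- `z ∈ ℚ(E[9])` and `z` is `Stab(ℤQ)`-invariant
  have hzL : (2 * ((θ ^ 3 - 24) / 3 ^ (k + 1) - (w₀ : AlgebraicClosure ℚ)) / θ) ^ 2 - 1 ∈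
      W.divisionField 9 :=
    sub_mem (pow_mem (div_mem (mul_mem (ofNat_mem _ 2) (sub_mem (div_mem (sub_mem (pow_mem hθL 3)
      (ofNat_mem _ 24)) (pow_mem (ofNat_mem _ 3) (k + 1))) (intCast_mem _ w₀))) hθL) 2) (one_mem _)
  have hfix : ∀ σ : absoluteGaloisGroup ℚ, (∃ c : ℤ, σ • Q = c • Q) →
      σ • ((2 * ((θ ^ 3 - 24) / 3 ^ (k + 1) - (w₀ : AlgebraicClosure ℚ)) / θ) ^ 2 - 1) =
        (2 * ((θ ^ 3 - 24) / 3 ^ (k + 1) - (w₀ : AlgebraicClosure ℚ)) / θ) ^ 2 - 1 := by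
    intro σ hσ
    have hθ' : absoluteGaloisGroup.toAlgEquiv ℚ σ θ = θ := by
      rw [← absoluteGaloisGroup.smul_def]; exact hθfix σ hσ
    rw [absoluteGaloisGroup.smul_def]
    simp only [map_sub, map_div₀, map_mul, map_pow, map_ofNat, map_one, map_intCast, hθ']
  -- (4) the scalar-stabiliser tower criterion with `d = 9`, `a = 0`, `b = 1`
  have hQ₉ : Q ∈ geomTorsion W 9 := (Submodule.mem_torsionBy_iff _ _).mpr hQ9
  have hval : v ((2 * ((θ ^ 3 - 24) / 3 ^ (k + 1) - (w₀ : AlgebraicClosure ℚ)) / θ) ^ 2 - 1) ^ 9 *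
      t ^ 0 = t ^ 1 := by
    rw [pow_zero, mul_one, pow_one]; exact hz
  have hcop : IsCoprime ((9 : ℕ) : ℤ) (((0 : ℕ) : ℤ) - ((1 : ℕ) : ℤ)) := ⟨0, -1, by norm_num⟩
  exact towerSurj_three_of_surj_of_valuation_of_smul_zmultiples W hsurj hQ₉ hzL hz0 hfix hval hcop
    (dvd_refl 9) n

/-- **Kato's (12.5.2) at `p = 3` on the family `v₃(j) = 3k + 3 ≥ 6`, `j/3^{v₃(j)} ≡ ±2 (mod 9)`**
from surj(3). [cite: Kato2004Asterisque, (12.5.2) (p. 222)] [cite: SerreAbelianLadic1968, Ch. IV §3.4, Lemma 3 (IV-23)] -/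
theorem imageContainsSL2_three_of_surj_of_nine_dvd_num_vzero
    (hsurj : W.HasSurjectiveModNGaloisRep 3) {k : ℕ} (hk : 1 ≤ k) {w₀ : ℤ}
    (hw₀ : w₀ = 1 ∨ w₀ = -1) (hj0 : (9 : ℤ) ∣ (W.j / 3 ^ (3 * k + 3) + 2 * w₀).num) :
    Kato2004.ImageContainsSL2 W 3 := by
  haveI : Fact (Nat.Prime 3) := ⟨Nat.prime_three⟩
  exact (Kato2004.imageContainsSL2_iff_forall_hasSurjectiveModNGaloisRep W 3).mpr
    (towerSurj_three_of_surj_of_nine_dvd_num_vzero W hsurj hk hw₀ hj0)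

end Summit.BirchSwinnertonDyer.Rank1Residual.GaloisImage
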